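import Literature.Analysis.FluidPDE.LocalTypeIWeakSerrinProofs
import HarnessLib

/-!
# Weak Serrin implies Type I, the `L^∞`-rate case, with DATA-UNIFORM constants
# (Albritton–Barker 2019, Lemma 2.5 / Lemma 2.6 — quantifier-uniform forms)

Analysis/FluidPDE proof file (theorems only; no definitions, no named facts), a companion of
`LocalTypeIWeakSerrinProofs.lean` (Albritton–Barker, J. Math. Fluid Mech. 21 (2019) = arXiv:1811.00502,
Lemma 2.5 with Remark 3.2 and Lemma 2.6).  The tree's `AlbrittonBarker2019.uniform_bound_of_interp`
and `albrittonBarker2019_lemma_2_5_rate_holds` produce, for ONE suitable weak solution, a finite level for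
the scaled quantities `A + E + C + D` on all sub-balls; their proofs build every constant from the
interpolation constant `κ`, the levels `A₀, D₀` (resp. the unit-scale data) and the absolute constants of the
local energy bound and of the pressure decay estimate ONLY — but the statements fix the solution before the
existential quantifier.  For compactness ACROSS solutions of one class (sequences of suitable weak solutions
with uniform data: e.g. the zooms at the singular points of a family of Leray–Hopf solutions with the same
life span, Type-I radius and initial energy) the uniform forms are needed; this file records them, with the
proofs of the originals (constants first, then the solution):

* `AlbrittonBarker2019.uniform_bound_of_interp_uniform` — Lemma 2.6 (Morrey case, interpolation
  `C ≤ κ A^{3/4}`): `∀ κ A₀ D₀ < ∞, ∃ K < ∞, ∀ (u, p, G) …, A + E + C + D ≤ K` on `Q(z', ρ)`, `ρ ≤ r₀/2`,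
  whenever `A(r₀; z') ≤ A₀`, `D(r₀; z') ≤ D₀`;
* `exists_typeIBound_le_of_rate` — Lemma 2.5, rate case: `∀ C C₀ P₁ E₁ R, ∃ B < ∞, ∀ (u, p, G)` in the
  unit ball with rate `C`, energy data `C₀`, `∬|p|^{3/2} ≤ P₁`, `∬|G|² ≤ E₁`: `𝐈(Q(z, R)) ≤ B`.

## References

* D. Albritton, T. Barker, J. Math. Fluid Mech. 21 (2019) = arXiv:1811.00502: §2, Def. 2.1, Lemma 2.5
  (and its proof), Lemma 2.6, Remark 3.2. [AlbrittonBarker2019]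
* G. Seregin, Zap. Nauchn. Sem. POMI 336 (2006) = J. Math. Sci. 143 (2007) (Lemma 2.6's source).
  [SereginCriticalMorrey2006]
* G. Seregin, V. Šverák, Comm. PDE 34 (2009), proof of Lemma 3.5, (as13). [SereginSverak2009]
-/

noncomputable section

open MeasureTheory Set Function Filter Topology TopologicalSpace Metric
open scoped NNReal ENNReal

namespace Literature.Analysis.FluidPDE

namespace AlbrittonBarker2019

open Seregin2020

/-- **Albritton–Barker 2019, Lemma 2.6 (Morrey case), quantifier-UNIFORM form** of the tree's
`uniform_bound_of_interp`: for all finite `κ, A₀, D₀` there is `K < ∞` such that for EVERY suitable weak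
solution `(u, p)` of the unforced unit-viscosity equations on an open `Q`, every weak spatial gradient `G`,
with `C(Q') ≤ κ A(Q')^{3/4}` on all parabolic balls `Q' ⊆ Q`, and every ball `Q(z', r₀) ⊆ Q` with
`A(r₀; z') ≤ A₀`, `D(r₀; z') ≤ D₀`: `A + E + C + D ≤ K` on all `Q(z', ρ)`, `0 < ρ ≤ r₀/2`.  Proof = the
original's, with the constants (which depend on `κ, A₀, D₀` and the absolute constants of
`localEnergyBound_top` / `seregin_sverak_pressure_decay_holds` only) assembled before the solution is
introduced. [cite: AlbrittonBarker2019, Lemma 2.6 and proof of Lemma 2.5 (arXiv:1811.00502 §2); Seregin2014 §6.1] -/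
theorem uniform_bound_of_interp_uniform {κ : ℝ≥0∞} (hκ : κ ≠ ∞) {A₀ D₀ : ℝ≥0∞} (hA₀ : A₀ ≠ ∞) (hD₀ : D₀ ≠ ∞) :
    ∃ K : ℝ≥0∞, K ≠ ∞ ∧ ∀ (Q : Opens (ℝ × EuclideanSpace ℝ (Fin 3)))
      (u : ℝ → EuclideanSpace ℝ (Fin 3) → EuclideanSpace ℝ (Fin 3))
      (p : ℝ → EuclideanSpace ℝ (Fin 3) → ℝ)
      (G : ℝ → EuclideanSpace ℝ (Fin 3) → EuclideanSpace ℝ (Fin 3) →L[ℝ] EuclideanSpace ℝ (Fin 3)),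
      IsSuitableWeakSolutionOn Q 1 0 u p → HasWeakSpatialGradientOn Q u G →
      (∀ (z' : ℝ × EuclideanSpace ℝ (Fin 3)) (ρ : ℝ), 0 < ρ →
        parabolicCylinder ρ z' ⊆ (Q : Set (ℝ × EuclideanSpace ℝ (Fin 3))) →
        cknC ρ z' u ≤ κ * cknAEss ρ z' u ^ (3 / 4 : ℝ)) →
      ∀ (z' : ℝ × EuclideanSpace ℝ (Fin 3)) (r₀ : ℝ), 0 < r₀ →
      parabolicCylinder r₀ z' ⊆ (Q : Set (ℝ × EuclideanSpace ℝ (Fin 3))) →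
      cknAEss r₀ z' u ≤ A₀ → cknD r₀ z' p ≤ D₀ →
      ∀ ρ ∈ Ioc (0 : ℝ) (r₀ / 2),
        cknAEss ρ z' u + cknE ρ z' G + cknC ρ z' u + cknD ρ z' p ≤ K := by
  -- ### the constants of the three estimates
  obtain ⟨c, hc⟩ := seregin_sverak_pressure_decay_holds.ratio
  obtain ⟨c₁, c₂, c₃, HT⟩ := localEnergyBound_top
  -- `θ` with `c θ ≤ 1/4` and `θ ≤ 1/2`
  obtain ⟨θ, hθ, hθhalf, hcθ2⟩ := exists_ratio_mul_le_half (2 * c)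
  have hθ1 : θ ≤ 1 := hθhalf.trans (by norm_num)
  have hcθ : (c : ℝ≥0∞) * ENNReal.ofReal θ ≤ 2⁻¹ * 2⁻¹ := by
    calc (c : ℝ≥0∞) * ENNReal.ofReal θ = 2⁻¹ * (((2 * c : ℝ≥0) : ℝ≥0∞) * ENNReal.ofReal θ) := by
          push_cast
          rw [← mul_assoc, ← mul_assoc, ENNReal.inv_mul_cancel two_ne_zero ENNReal.ofNat_ne_top,
            one_mul]
      _ ≤ 2⁻¹ * 2⁻¹ := by gcongr
  -- the Young parameter `s` with `(2θ)⁻¹ c₃ s ≤ 1/4`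
  set L : ℝ≥0∞ := ENNReal.ofReal ((2 * θ)⁻¹) * c₃ with hL
  have hLtop : L ≠ ∞ := ENNReal.mul_ne_top ENNReal.ofReal_ne_top ENNReal.coe_ne_top
  set s : ℝ≥0∞ := 2⁻¹ * 2⁻¹ * (L + 1)⁻¹ with hs
  have h2i0 : (2⁻¹ : ℝ≥0∞) ≠ 0 := ENNReal.inv_ne_zero.2 ENNReal.ofNat_ne_top
  have h2it : (2⁻¹ : ℝ≥0∞) ≠ ∞ := ENNReal.inv_ne_top.2 two_ne_zero
  have hs0 : s ≠ 0 := mul_ne_zero (mul_ne_zero h2i0 h2i0)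
    (ENNReal.inv_ne_zero.2 (ENNReal.add_ne_top.2 ⟨hLtop, ENNReal.one_ne_top⟩))
  have hstop : s ≠ ∞ := ENNReal.mul_ne_top (ENNReal.mul_ne_top h2it h2it)
    (ENNReal.inv_ne_top.2 (by simp))
  have hLs : L * s ≤ 2⁻¹ * 2⁻¹ := by
    have h1 : L * (L + 1)⁻¹ ≤ 1 := by
      rw [← div_eq_mul_inv]
      exact ENNReal.div_le_of_le_mul (by rw [one_mul]; exact le_self_add)
    calc L * s = 2⁻¹ * 2⁻¹ * (L * (L + 1)⁻¹) := by rw [hs]; ring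
      _ ≤ 2⁻¹ * 2⁻¹ * 1 := by gcongr
      _ = 2⁻¹ * 2⁻¹ := mul_one _
  -- coefficients of `A^{1/2}` and `A^{3/4}`, and the absorption constants
  set α₁ : ℝ≥0∞ := ENNReal.ofReal ((2 * θ)⁻¹) * c₁ * κ ^ (2 / 3 : ℝ) with hα₁
  set α₂ : ℝ≥0∞ := (ENNReal.ofReal ((2 * θ)⁻¹) * (c₂ + c₃ * s⁻¹ ^ 2) +
    c * ENNReal.ofReal (θ⁻¹ ^ 2)) * κ with hα₂
  have hsi : s⁻¹ ≠ ∞ := ENNReal.inv_ne_top.2 hs0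
  have hα₁top : α₁ ≠ ∞ := ENNReal.mul_ne_top
    (ENNReal.mul_ne_top ENNReal.ofReal_ne_top ENNReal.coe_ne_top)
    (ENNReal.rpow_ne_top_of_nonneg (by norm_num) hκ)
  have hα₂top : α₂ ≠ ∞ := by
    refine ENNReal.mul_ne_top (ENNReal.add_ne_top.2 ⟨?_, ?_⟩) hκ
    · exact ENNReal.mul_ne_top ENNReal.ofReal_ne_top (ENNReal.add_ne_top.2 ⟨ENNReal.coe_ne_top,
        ENNReal.mul_ne_top ENNReal.coe_ne_top (ENNReal.pow_ne_top hsi)⟩)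
    · exact ENNReal.mul_ne_top ENNReal.coe_ne_top ENNReal.ofReal_ne_top
  set ε : ℝ≥0∞ := 2⁻¹ * 2⁻¹ with hε
  have hε0 : ε ≠ 0 := mul_ne_zero h2i0 h2i0
  have hεtop : ε ≠ ∞ := ENNReal.mul_ne_top h2it h2it
  have hεi : ε⁻¹ ≠ ∞ := ENNReal.inv_ne_top.2 hε0
  set K₁ : ℝ≥0∞ := (α₁ * ε⁻¹ ^ (1 / 2 : ℝ)) ^ (1 / (1 - 1 / 2 : ℝ)) with hK₁
  set K₂ : ℝ≥0∞ := (α₂ * ε⁻¹ ^ (3 / 4 : ℝ)) ^ (1 / (1 - 3 / 4 : ℝ)) with hK₂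
  have hK₁top : K₁ ≠ ∞ := ENNReal.rpow_ne_top_of_nonneg (by norm_num)
    (ENNReal.mul_ne_top hα₁top (ENNReal.rpow_ne_top_of_nonneg (by norm_num) hεi))
  have hK₂top : K₂ ≠ ∞ := ENNReal.rpow_ne_top_of_nonneg (by norm_num)
    (ENNReal.mul_ne_top hα₂top (ENNReal.rpow_ne_top_of_nonneg (by norm_num) hεi))
  set b : ℝ≥0∞ := K₁ + K₂ with hb
  have hbtop : b ≠ ∞ := ENNReal.add_ne_top.2 ⟨hK₁top, hK₂top⟩
  -- ### the constants of the conclusion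
  set Ψ₀ : ℝ≥0∞ := 2 * b + (A₀ + D₀) with hΨ₀
  have hΨ₀top : Ψ₀ ≠ ∞ := ENNReal.add_ne_top.2
    ⟨ENNReal.mul_ne_top ENNReal.ofNat_ne_top hbtop, ENNReal.add_ne_top.2 ⟨hA₀, hD₀⟩⟩
  set Abar : ℝ≥0∞ := ENNReal.ofReal (θ⁻¹) * Ψ₀ with hAbar
  have hAbartop : Abar ≠ ∞ := ENNReal.mul_ne_top ENNReal.ofReal_ne_top hΨ₀top
  set M : ℝ≥0∞ := κ * Abar ^ (3 / 4 : ℝ) with hM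
  have hMtop : M ≠ ∞ := ENNReal.mul_ne_top hκ (ENNReal.rpow_ne_top_of_nonneg (by norm_num) hAbartop)
  -- a second ratio `θ'` for the pressure iteration, `c θ' ≤ 1/2`
  obtain ⟨θ', hθ', hθ'half, hcθ'⟩ := exists_ratio_mul_le_half c
  have hθ'1 : θ' ≤ 1 := hθ'half.trans (by norm_num)
  set BB : ℝ≥0∞ := D₀ + 2 * (c * ENNReal.ofReal ((θ'⁻¹) ^ 2) * M) with hBB
  have hBBtop : BB ≠ ∞ := by
    refine ENNReal.add_ne_top.2 ⟨hD₀, ENNReal.mul_ne_top ENNReal.ofNat_ne_top ?_⟩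
    exact ENNReal.mul_ne_top (ENNReal.mul_ne_top ENNReal.coe_ne_top ENNReal.ofReal_ne_top) hMtop
  set B' : ℝ≥0∞ := ENNReal.ofReal (θ'⁻¹) ^ 2 * BB with hB'
  have hB'top : B' ≠ ∞ := ENNReal.mul_ne_top (ENNReal.pow_ne_top ENNReal.ofReal_ne_top) hBBtop
  set K : ℝ≥0∞ := c₁ * M ^ (2 / 3 : ℝ) + c₂ * M + c₃ * (B' ^ (2 / 3 : ℝ) * M ^ (1 / 3 : ℝ)) + M + B'
    with hK
  have hKtop : K ≠ ∞ := by
    have hM23 : M ^ (2 / 3 : ℝ) ≠ ∞ := ENNReal.rpow_ne_top_of_nonneg (by norm_num) hMtop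
    have hM13 : M ^ (1 / 3 : ℝ) ≠ ∞ := ENNReal.rpow_ne_top_of_nonneg (by norm_num) hMtop
    have hB23 : B' ^ (2 / 3 : ℝ) ≠ ∞ := ENNReal.rpow_ne_top_of_nonneg (by norm_num) hB'top
    rw [hK]
    refine ENNReal.add_ne_top.2 ⟨ENNReal.add_ne_top.2 ⟨ENNReal.add_ne_top.2
      ⟨ENNReal.add_ne_top.2 ⟨?_, ?_⟩, ?_⟩, hMtop⟩, hB'top⟩
    · exact ENNReal.mul_ne_top ENNReal.coe_ne_top hM23
    · exact ENNReal.mul_ne_top ENNReal.coe_ne_top hMtop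
    · exact ENNReal.mul_ne_top ENNReal.coe_ne_top (ENNReal.mul_ne_top hB23 hM13)
  refine ⟨K, hKtop, fun Q u p G hsw hG hinterp z' r₀ hr₀ hQ hAr₀ hDr₀ => ?_⟩
  -- ### the one-step inequality for `Ψ = A + D`, uniformly in the centre
  have step : ∀ (z' : ℝ × EuclideanSpace ℝ (Fin 3)) (R : ℝ), 0 < R →
      parabolicCylinder R z' ⊆ (Q : Set (ℝ × EuclideanSpace ℝ (Fin 3))) →
      cknAEss (θ * R) z' u + cknD (θ * R) z' p ≤ (cknAEss R z' u + cknD R z' p) / 2 + b := by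
    intro z' R hR0 hQR
    set AA := cknAEss R z' u with hAA
    set D := cknD R z' p with hDdef
    set C := cknC R z' u with hCdef
    -- the energy at `θR` through `R/2`
    have hA1 : cknAEss (θ * R) z' u ≤ ENNReal.ofReal ((2 * θ)⁻¹) *
        (c₁ * C ^ (2 / 3 : ℝ) + c₂ * C + c₃ * (D ^ (2 / 3 : ℝ) * C ^ (1 / 3 : ℝ))) := by
      have hθR : θ * R ≤ R / 2 := by nlinarith
      have hI : Ioo (z'.1 - (θ * R) ^ 2) z'.1 ⊆ Ioo (z'.1 - (R / 2) ^ 2) z'.1 :=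
        Ioo_subset_Ioo (by nlinarith [pow_le_pow_left₀ (mul_pos hθ hR0).le hθR 2]) le_rfl
      have hB : ball z'.2 (θ * R) ⊆ ball z'.2 (R / 2) := ball_subset_ball hθR
      have hmono := cknAEss_le_mul_of_subset (half_pos hR0) (mul_pos hθ hR0) hI hB u
      have e1 : R / 2 / (θ * R) = (2 * θ)⁻¹ := by field_simp
      rw [e1] at hmono
      have hT := HT Q u p G hsw hG z' R hR0 hQR
      calc cknAEss (θ * R) z' u ≤ ENNReal.ofReal ((2 * θ)⁻¹) * cknAEss (R / 2) z' u := hmono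
        _ ≤ ENNReal.ofReal ((2 * θ)⁻¹) * (cknAEss (R / 2) z' u + cknE (R / 2) z' G) := by
            gcongr; exact le_self_add
        _ ≤ _ := by gcongr
    -- the pressure at `θR`
    have hD1 : cknD (θ * R) z' p ≤
        c * (ENNReal.ofReal θ * D + ENNReal.ofReal ((θ⁻¹) ^ 2) * C) :=
      hc Q u p hsw.distributional z' R θ hR0 hθ hθ1 hQR
    -- Young for the mixed term
    have hY : D ^ (2 / 3 : ℝ) * C ^ (1 / 3 : ℝ) ≤ s * D + s⁻¹ ^ 2 * C :=
      rpow_two_thirds_mul_rpow_one_third_le D C hs0 hstop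
    -- the interpolation
    have hCR : C ≤ κ * AA ^ (3 / 4 : ℝ) := hinterp z' R hR0 hQR
    have hCR23 : C ^ (2 / 3 : ℝ) ≤ κ ^ (2 / 3 : ℝ) * AA ^ (1 / 2 : ℝ) := by
      calc C ^ (2 / 3 : ℝ) ≤ (κ * AA ^ (3 / 4 : ℝ)) ^ (2 / 3 : ℝ) :=
          ENNReal.rpow_le_rpow hCR (by norm_num)
        _ = κ ^ (2 / 3 : ℝ) * AA ^ (1 / 2 : ℝ) := by
          rw [ENNReal.mul_rpow_of_nonneg _ _ (by norm_num), ← ENNReal.rpow_mul]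
          norm_num
    -- absorption of the sublinear powers of `AA`
    have hab1 : α₁ * AA ^ (1 / 2 : ℝ) ≤ ε * AA + K₁ :=
      rpow_le_mul_add (by norm_num) (by norm_num) α₁ AA hε0 hεtop
    have hab2 : α₂ * AA ^ (3 / 4 : ℝ) ≤ ε * AA + K₂ :=
      rpow_le_mul_add (by norm_num) (by norm_num) α₂ AA hε0 hεtop
    -- combine
    calc cknAEss (θ * R) z' u + cknD (θ * R) z' p
        ≤ ENNReal.ofReal ((2 * θ)⁻¹) *
            (c₁ * C ^ (2 / 3 : ℝ) + c₂ * C + c₃ * (s * D + s⁻¹ ^ 2 * C)) +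
          c * (ENNReal.ofReal θ * D + ENNReal.ofReal ((θ⁻¹) ^ 2) * C) := by
          gcongr
          exact hA1.trans (by gcongr)
      _ = (L * s) * D + (c * ENNReal.ofReal θ) * D +
          ENNReal.ofReal ((2 * θ)⁻¹) * c₁ * C ^ (2 / 3 : ℝ) +
          (ENNReal.ofReal ((2 * θ)⁻¹) * (c₂ + c₃ * s⁻¹ ^ 2) + c * ENNReal.ofReal (θ⁻¹ ^ 2)) * C := by
          rw [hL]; ring
      _ ≤ (2⁻¹ * 2⁻¹) * D + (2⁻¹ * 2⁻¹) * D +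
          ENNReal.ofReal ((2 * θ)⁻¹) * c₁ * (κ ^ (2 / 3 : ℝ) * AA ^ (1 / 2 : ℝ)) +
          (ENNReal.ofReal ((2 * θ)⁻¹) * (c₂ + c₃ * s⁻¹ ^ 2) + c * ENNReal.ofReal (θ⁻¹ ^ 2)) *
            (κ * AA ^ (3 / 4 : ℝ)) := by
          gcongr
      _ = 2⁻¹ * D + α₁ * AA ^ (1 / 2 : ℝ) + α₂ * AA ^ (3 / 4 : ℝ) := by
          rw [quarter_add_quarter, hα₁, hα₂]; ring
      _ ≤ 2⁻¹ * D + (ε * AA + K₁) + (ε * AA + K₂) := by gcongr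
      _ = 2⁻¹ * D + 2⁻¹ * AA + K₁ + K₂ := by
          rw [hε, ← quarter_add_quarter AA]; ring
      _ = (AA + D) / 2 + b := by
          rw [hb, div_eq_mul_inv]; ring
  -- ### the iteration along `θᵏ r₀`
  have hiter : ∀ k : ℕ, cknAEss (θ ^ k * r₀) z' u + cknD (θ ^ k * r₀) z' p ≤ Ψ₀ := by
    intro k
    have := iterate_half_le (φ := fun ρ => cknAEss ρ z' u + cknD ρ z' p) hθ hθ1 hr₀
      (fun R hR0 hRr => step z' R hR0 ((parabolicCylinder_mono hR0.le hRr z').trans hQ)) k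
    refine this.trans ?_
    rw [hΨ₀]
    gcongr
    calc (2⁻¹ : ℝ≥0∞) ^ k * (cknAEss r₀ z' u + cknD r₀ z' p) ≤ 1 * (A₀ + D₀) := by
          gcongr
          exact pow_le_one₀ zero_le (ENNReal.inv_le_one.2 one_le_two)
      _ = _ := one_mul _
  -- ### `A` at every radius `0 < r ≤ r₀`
  have hAr : ∀ r ∈ Ioc (0 : ℝ) r₀, cknAEss r z' u ≤ Abar := by
    intro r hr
    obtain ⟨J, hJ1, hJ2⟩ := exists_nat_pow_near_of_lt_one (div_pos hr.1 hr₀)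
      ((div_le_one hr₀).2 hr.2) hθ (by linarith)
    have hle : r ≤ θ ^ J * r₀ := by rwa [div_le_iff₀ hr₀] at hJ2
    have hlt : θ ^ J * r₀ < θ⁻¹ * r := by
      rw [lt_div_iff₀ hr₀] at hJ1
      have : θ ^ J * r₀ = θ⁻¹ * (θ ^ (J + 1) * r₀) := by
        rw [pow_succ]; field_simp
      rw [this]
      exact mul_lt_mul_of_pos_left hJ1 (inv_pos.2 hθ)
    have hI : Ioo (z'.1 - r ^ 2) z'.1 ⊆ Ioo (z'.1 - (θ ^ J * r₀) ^ 2) z'.1 :=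
      Ioo_subset_Ioo (by nlinarith [pow_le_pow_left₀ hr.1.le hle 2]) le_rfl
    have hB : ball z'.2 r ⊆ ball z'.2 (θ ^ J * r₀) := ball_subset_ball hle
    calc cknAEss r z' u ≤ ENNReal.ofReal (θ ^ J * r₀ / r) * cknAEss (θ ^ J * r₀) z' u :=
          cknAEss_le_mul_of_subset (by positivity) hr.1 hI hB u
      _ ≤ ENNReal.ofReal (θ⁻¹) * Ψ₀ := by
          gcongr
          · exact (div_le_iff₀ hr.1).2 hlt.le
          · exact le_self_add.trans (hiter J)
  -- ### `C` bounded by `M` on `]0, r₀]`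
  have hCb : ∀ r ∈ Ioc (0 : ℝ) r₀, cknC r z' u ≤ M := by
    intro r hr
    refine (hinterp z' r hr.1 ((parabolicCylinder_mono hr.1.le hr.2 z').trans hQ)).trans ?_
    rw [hM]
    gcongr
    exact hAr r hr
  -- ### `D` along the scales `θ'ᴶ r₀` and at every radius
  have hDJ : ∀ J : ℕ, cknD (θ' ^ J * r₀) z' p ≤ BB := by
    intro J
    have hCj : ∀ j < J, cknC (θ' ^ j * r₀) z' u ≤ M := fun j _ =>
      hCb _ ⟨by positivity, mul_le_of_le_one_left hr₀.le (pow_le_one₀ hθ'.le hθ'1)⟩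
    refine (cknD_iterate_le_of_pressure_decay hc hθ' hθ'1 hcθ' hsw.distributional hr₀ hQ
      hCj).trans ?_
    rw [hBB]
    gcongr
    calc (2⁻¹ : ℝ≥0∞) ^ J * cknD r₀ z' p ≤ 1 * D₀ := by
          gcongr
          exact pow_le_one₀ zero_le (ENNReal.inv_le_one.2 one_le_two)
      _ = D₀ := one_mul _
  have hDr : ∀ r ∈ Ioc (0 : ℝ) r₀, cknD r z' p ≤ B' := by
    intro r hr
    obtain ⟨J, hJ1, hJ2⟩ := exists_nat_pow_near_of_lt_one (div_pos hr.1 hr₀)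
      ((div_le_one hr₀).2 hr.2) hθ' (by linarith)
    have hle : r ≤ θ' ^ J * r₀ := by rwa [div_le_iff₀ hr₀] at hJ2
    have hlt : θ' ^ J * r₀ < θ'⁻¹ * r := by
      rw [lt_div_iff₀ hr₀] at hJ1
      have : θ' ^ J * r₀ = θ'⁻¹ * (θ' ^ (J + 1) * r₀) := by
        rw [pow_succ]; field_simp
      rw [this]
      exact mul_lt_mul_of_pos_left hJ1 (inv_pos.2 hθ')
    have hsub : parabolicCylinder r z' ⊆ parabolicCylinder (θ' ^ J * r₀) z' :=
      parabolicCylinder_mono hr.1.le hle z'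
    calc cknD r z' p ≤ ENNReal.ofReal (θ' ^ J * r₀ / r) ^ 2 * cknD (θ' ^ J * r₀) z' p :=
          cknD_le_mul_of_subset (by positivity) hr.1 hsub p
      _ ≤ ENNReal.ofReal (θ'⁻¹) ^ 2 * BB := by
          gcongr
          · exact (div_le_iff₀ hr.1).2 hlt.le
          · exact hDJ J
  -- ### conclusion from the local energy bound at `2ρ`
  intro ρ hρ
  have h2r : 2 * ρ ∈ Ioc (0 : ℝ) r₀ := ⟨by linarith [hρ.1], by linarith [hρ.2]⟩
  have hrr : ρ ∈ Ioc (0 : ℝ) r₀ := ⟨hρ.1, by linarith [hρ.2]⟩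
  have hAE := HT Q u p G hsw hG z' (2 * ρ) h2r.1
    ((parabolicCylinder_mono (by linarith [hρ.1]) h2r.2 z').trans hQ)
  rw [show 2 * ρ / 2 = ρ by ring] at hAE
  have hC2 : cknC (2 * ρ) z' u ≤ M := hCb _ h2r
  have hD2 : cknD (2 * ρ) z' p ≤ B' := hDr _ h2r
  calc cknAEss ρ z' u + cknE ρ z' G + cknC ρ z' u + cknD ρ z' p
      ≤ (c₁ * cknC (2 * ρ) z' u ^ (2 / 3 : ℝ) + c₂ * cknC (2 * ρ) z' u +
          c₃ * (cknD (2 * ρ) z' p ^ (2 / 3 : ℝ) * cknC (2 * ρ) z' u ^ (1 / 3 : ℝ))) +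
          M + B' := add_le_add (add_le_add hAE (hCb ρ hrr)) (hDr ρ hrr)
    _ ≤ K := by
        rw [hK]
        gcongr

/-! ### Unit-scale energy data on sub-balls -/

end AlbrittonBarker2019

open AlbrittonBarker2019 in
/-- **Albritton–Barker 2019, Lemma 2.5 (rate case) with an EXPLICIT, DATA-UNIFORM level.**  For every rate
constant `C`, energy level `C₀`, pressure level `P₁ < ∞`, dissipation level `E₁ < ∞` and radius `R < 1` there
is `B < ∞` such that EVERY suitable weak solution `(u, p)` of Navier–Stokes in a unit parabolic ball `Q(z, 1)`
(Def. 2.1) with the rate `|u(s, y)| ≤ C/√(t − s)` there, a weak spatial gradient `G` on the ball, energy data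
`esssup_s ∫_{B(x,1)} |u(s)|² ≤ C₀`, `∬_{Q(z,1)} |p|^{3/2} ≤ P₁` and `∬_{Q(z,1)} |G|² ≤ E₁` has `𝐈(Q(z, R)) ≤ B`.  This is
the tree's `albrittonBarker2019_lemma_2_5_rate_holds` with its constants assembled BEFORE the solution (they depend on
`C, C₀, P₁, E₁, R` only: rate interpolation `C ≤ κ(C) A^{3/4}`, `uniform_bound_of_interp_uniform`, unit-scale data on
large sub-balls). [cite: AlbrittonBarker2019, Lemma 2.5 and Remark 3.2 (arXiv:1811.00502 §2, §3)] -/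
theorem exists_typeIBound_le_of_rate (C : ℝ) (C₀ : ℝ≥0) {P₁ E₁ : ℝ≥0∞} (hP₁ : P₁ ≠ ∞) (hE₁ : E₁ ≠ ∞)
    {R : ℝ} (hR1 : R < 1) :
    ∃ B : ℝ≥0∞, B ≠ ∞ ∧ ∀ (z : ℝ × EuclideanSpace ℝ (Fin 3))
      (u : ℝ → EuclideanSpace ℝ (Fin 3) → EuclideanSpace ℝ (Fin 3)) (p : ℝ → EuclideanSpace ℝ (Fin 3) → ℝ)
      (G : ℝ → EuclideanSpace ℝ (Fin 3) → EuclideanSpace ℝ (Fin 3) →L[ℝ] EuclideanSpace ℝ (Fin 3)),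
      IsSuitableWeakSolutionInBall 1 z u p →
      (∀ t' x', (t', x') ∈ parabolicCylinder 1 z → ‖u t' x'‖ ≤ C / Real.sqrt (z.1 - t')) →
      HasWeakSpatialGradientOn (parabolicCylinderOpens 1 z) u G →
      (∀ᵐ s ∂(volume.restrict (Ioo (z.1 - 1 ^ 2) z.1)), ∫⁻ y in ball z.2 1, ‖u s y‖ₑ ^ 2 ≤ C₀) →
      ∫⁻ w in parabolicCylinder 1 z, ‖p w.1 w.2‖ₑ ^ (3 / 2 : ℝ) ≤ P₁ →
      ∫⁻ w in parabolicCylinder 1 z, ENNReal.ofReal (frobeniusNormSq (G w.1 w.2)) ≤ E₁ →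
      typeIBound (parabolicCylinder R z) u p G ≤ B := by
  -- the room `δ`
  set δ : ℝ := 1 - R with hδ
  have hδ0 : 0 < δ := by rw [hδ]; linarith
  -- ### the rate-interpolation constant
  set κ : ℝ≥0∞ := 4 * volume (ball (0 : EuclideanSpace ℝ (Fin 3)) 1) ^ (1 / 4 : ℝ) *
    ENNReal.ofReal (|C| ^ (3 / 2 : ℝ)) with hκ
  have hκtop : κ ≠ ∞ := ENNReal.mul_ne_top (ENNReal.mul_ne_top ENNReal.ofNat_ne_top
    (ENNReal.rpow_ne_top_of_nonneg (by norm_num) measure_ball_lt_top.ne)) ENNReal.ofReal_ne_top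
  -- ### unit-scale levels
  have hδi : (ENNReal.ofReal δ)⁻¹ ≠ ∞ := ENNReal.inv_ne_top.2 (ENNReal.ofReal_pos.2 hδ0).ne'
  have hδi2 : (ENNReal.ofReal δ ^ 2)⁻¹ ≠ ∞ :=
    ENNReal.inv_ne_top.2 (pow_ne_zero _ (ENNReal.ofReal_pos.2 hδ0).ne')
  set A₀ : ℝ≥0∞ := (ENNReal.ofReal δ)⁻¹ * C₀ with hA₀
  have hA₀top : A₀ ≠ ∞ := ENNReal.mul_ne_top hδi ENNReal.coe_ne_top
  set D₀ : ℝ≥0∞ := (ENNReal.ofReal δ ^ 2)⁻¹ * P₁ with hD₀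
  have hD₀top : D₀ ≠ ∞ := ENNReal.mul_ne_top hδi2 hP₁
  set E₀ : ℝ≥0∞ := (ENNReal.ofReal δ)⁻¹ * E₁ with hE₀
  have hE₀top : E₀ ≠ ∞ := ENNReal.mul_ne_top hδi hE₁
  -- ### the uniform bound on small balls and the bound on large balls
  obtain ⟨K, hKtop, hK⟩ := uniform_bound_of_interp_uniform hκtop hA₀top hD₀top
  set Kbig : ℝ≥0∞ := A₀ + κ * A₀ ^ (3 / 4 : ℝ) + 4 * D₀ + E₀ with hKbig
  have hKbigtop : Kbig ≠ ∞ := by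
    refine ENNReal.add_ne_top.2 ⟨ENNReal.add_ne_top.2 ⟨ENNReal.add_ne_top.2 ⟨hA₀top, ?_⟩, ?_⟩,
      hE₀top⟩
    · exact ENNReal.mul_ne_top hκtop (ENNReal.rpow_ne_top_of_nonneg (by norm_num) hA₀top)
    · exact ENNReal.mul_ne_top ENNReal.ofNat_ne_top hD₀top
  have htop : 4 * K + Kbig ≠ ∞ :=
    ENNReal.add_ne_top.2 ⟨ENNReal.mul_ne_top ENNReal.ofNat_ne_top hKtop, hKbigtop⟩
  refine ⟨4 * K + Kbig, htop, fun z u p G hswB hrate hG hC₀ hP₁le hE₁le => ?_⟩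
  obtain ⟨hsw, -, -, hp⟩ := hswB
  -- the domain
  set Q : Opens (ℝ × EuclideanSpace ℝ (Fin 3)) := parabolicCylinderOpens 1 z with hQdef
  have hQ : (Q : Set (ℝ × EuclideanSpace ℝ (Fin 3))) = parabolicCylinder 1 z := rfl
  -- the rate with a nonnegative constant
  have hrate' : ∀ s y, (s, y) ∈ parabolicCylinder 1 z → ‖u s y‖ ≤ |C| / Real.sqrt (z.1 - s) :=
    fun s y h => (hrate s y h).trans
      (div_le_div_of_nonneg_right (le_abs_self C) (Real.sqrt_nonneg _))
  -- measurability of `u` and `p` on the unit ball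
  have hu : AEStronglyMeasurable (uncurry u) (volume.restrict (parabolicCylinder 1 z)) :=
    hsw.distributional.1.aestronglyMeasurable
  have hpm : AEStronglyMeasurable (uncurry p) (volume.restrict (parabolicCylinder 1 z)) :=
    hp.aestronglyMeasurable
  -- ### the rate interpolation on every sub-ball
  have hinterp : ∀ (z' : ℝ × EuclideanSpace ℝ (Fin 3)) (ρ : ℝ), 0 < ρ →
      parabolicCylinder ρ z' ⊆ (Q : Set (ℝ × EuclideanSpace ℝ (Fin 3))) →
      cknC ρ z' u ≤ κ * cknAEss ρ z' u ^ (3 / 4 : ℝ) := fun z' ρ hρ hsub =>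
    cknC_le_of_rate (abs_nonneg C) hu hrate' hρ (by rwa [hQ] at hsub)
  -- the data of a sub-ball `Q(z', ρ) ⊆ Q(z, 1)` of radius `ρ ≥ δ`
  have hdataA : ∀ (z' : ℝ × EuclideanSpace ℝ (Fin 3)) (ρ : ℝ), δ ≤ ρ →
      parabolicCylinder ρ z' ⊆ parabolicCylinder 1 z → cknAEss ρ z' u ≤ A₀ := by
    intro z' ρ hδρ hsub
    have hρ : 0 < ρ := hδ0.trans_le hδρ
    refine (cknAEss_le_of_energyClass hC₀ hρ hsub).trans ?_
    rw [hA₀]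
    exact mul_le_mul' (ENNReal.inv_le_inv.2 (ENNReal.ofReal_le_ofReal hδρ)) le_rfl
  have hdataD : ∀ (z' : ℝ × EuclideanSpace ℝ (Fin 3)) (ρ : ℝ), δ ≤ ρ →
      parabolicCylinder ρ z' ⊆ parabolicCylinder 1 z → cknD ρ z' p ≤ D₀ := by
    intro z' ρ hδρ hsub
    rw [cknD, hD₀]
    refine mul_le_mul' (ENNReal.inv_le_inv.2 ?_) ((lintegral_mono_set hsub).trans hP₁le)
    gcongr
  have hdataE : ∀ (z' : ℝ × EuclideanSpace ℝ (Fin 3)) (ρ : ℝ), δ ≤ ρ →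
      parabolicCylinder ρ z' ⊆ parabolicCylinder 1 z → cknE ρ z' G ≤ E₀ := by
    intro z' ρ hδρ hsub
    rw [cknE, hE₀]
    exact mul_le_mul' (ENNReal.inv_le_inv.2 (ENNReal.ofReal_le_ofReal hδρ))
      ((lintegral_mono_set hsub).trans hE₁le)
  have hK' := hK Q u p G hsw hG hinterp
  -- ### conclusion
  refine typeIBound_le_iff.2 fun r hr z' hzr => ?_
  -- room: `Q(z', ρ) ⊆ Q(z, 1)` for `ρ ≤ r + δ`
  have hroom : ∀ ρ, 0 < ρ → ρ ≤ r + δ → parabolicCylinder ρ z' ⊆ parabolicCylinder 1 z :=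
    fun ρ hρ0 hρ => parabolicCylinder_subset_one_of_subset hr hR1.le hzr hρ0 (by rwa [hδ] at hρ)
  have hsub1 : parabolicCylinder r z' ⊆ parabolicCylinder 1 z := hroom r hr (by linarith)
  -- `D_osc ≤ 4 D` on the ball
  have hOsc : cknDOsc r z' p ≤ 4 * cknD r z' p :=
    cknDOsc_le_four_mul_cknD hr (hpm.mono_measure (Measure.restrict_mono hsub1 le_rfl))
  rw [abScaledSum]
  rcases le_or_gt r δ with hrδ | hrδ
  · -- small ball: the iteration started from `r₀ = r + δ ∈ [δ, 2δ]`
    have hr₀ : 0 < r + δ := by linarith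
    have hsub₀ := hroom (r + δ) hr₀ le_rfl
    have hKr := hK' z' (r + δ) hr₀ (by rw [hQ]; exact hsub₀) (hdataA z' _ (by linarith) hsub₀)
      (hdataD z' _ (by linarith) hsub₀) r ⟨hr, by linarith⟩
    calc cknAEss r z' u + cknC r z' u + cknDOsc r z' p + cknE r z' G
        ≤ 4 * cknAEss r z' u + 4 * cknC r z' u + 4 * cknD r z' p + 4 * cknE r z' G :=
          add_le_add (add_le_add (add_le_add (le_four_mul _) (le_four_mul _)) hOsc) (le_four_mul _)
      _ = 4 * (cknAEss r z' u + cknE r z' G + cknC r z' u + cknD r z' p) := by ring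
      _ ≤ 4 * K := by gcongr
      _ ≤ 4 * K + Kbig := le_self_add
  · -- large ball: unit-scale data
    have hA := hdataA z' r hrδ.le hsub1
    have hC : cknC r z' u ≤ κ * A₀ ^ (3 / 4 : ℝ) :=
      (hinterp z' r hr (by rw [hQ]; exact hsub1)).trans (by gcongr)
    calc cknAEss r z' u + cknC r z' u + cknDOsc r z' p + cknE r z' G
        ≤ A₀ + κ * A₀ ^ (3 / 4 : ℝ) + 4 * D₀ + E₀ := by
          gcongr
          · exact hOsc.trans (mul_le_mul' le_rfl (hdataD z' r hrδ.le hsub1))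
          · exact hdataE z' r hrδ.le hsub1
      _ = Kbig := by rw [hKbig]
      _ ≤ 4 * K + Kbig := le_add_self

end Literature.Analysis.FluidPDE

end
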